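import Summits.BirchSwinnertonDyer.BirchSwinnertonDyer.Theorems.PrintCFramBottomClassIndexLawFiveLeCuspSeedCutFamilyFubini
import Summits.BirchSwinnertonDyer.BirchSwinnertonDyer.Theorems.PrintCFramBottomClassIndexLawFiveLeCuspSeedDoubleSumCollapse
import Summits.BirchSwinnertonDyer.BirchSwinnertonDyer.Theorems.PrintCFramBottomClassIndexLawFiveLeCuspSeedFamilyMean
import Mathlib.Analysis.Normed.Group.Tannery
import Mathlib.NumberTheory.LSeries.Deriv
import HarnessLib

set_option autoImplicit false

/-!
# Crux `PrintCFram.BottomClassIndexLawFiveLe` (stmt-BirchSwinnertonDyer-20372), line `eisenstein-resource-bdp-line` (registry v24/v25):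
# (E3) OF THE CUSP-CONJUNCT ASSEMBLY, ANALYTIC PART 4 — THE RESIDUE OF THE CUT COHEN `L`-SERIES AT `s = k + 1/2`
# (cell `bsd-print-cfram`, width seat `bsd-line-cfram-p1-w5` g6; THEOREMS ONLY, `--supports` 20372; BSD is not proved by any of this)

HONEST FRAMING. Analysis in raw-`LSeries` currency; nothing modular; no summit statement, no stub closed. THE RESULT of the w5 lane's (E):
for `e` a fundamental discriminant or `1` (`m = |e|`, odd OR even), parity `(−1)^k m = −e`, `k ≥ 2`, `w = k + 1/2`,
**`tendsto_sub_mul_LSeries_ite_cut_cohenH`**: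
`(s − w)·Σ_{a ∈ CUT} H(k,a) a^{−s} → R = (−1)^{⌊k/2⌋}(k−1)!/2^{k−1} · π^{−k} · κ_m · L(𝟙_{⊥m}, 2k) · m^{−1}` as `s → w⁺` (real `s`),
`κ_m = (1/8 | 1/4)·(1 | 2/3)·Π_{q ∈ m.primeFactors ∖ {2}}(q−1)/(2q)` (w3 g13's density constant), `L(𝟙_{⊥m},2k) = ζ(2k)Π_{q∣m}(1−q^{−2k})`
— the residue of crux notes `Lines/eisenstein-resource-bdp-line-w5g5-cusp-seed.md` §0/§5 (numerically certified there to 8 digits), for the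
registered `a = m·n'` indexing (`m^{−w}·m^{k−1}·√m = m^{−1}`; check: `k = 2, m = 3` gives `−π²/6561` on both sides). STEPS:
`tendsto_tsum_term_mul_term_mul_family` (Tannery over `(a,b)`; domination by w3 g13 `FamilyMean.eventually_norm_sub_one_mul_LSeries_le`; pointwise
limits = the family means, kept ABSTRACT as `Dl`), `tendsto_elementaryFactor` (continuity of `c_kπ^{−k}L(𝟙,2s)L(𝟙id^{2k−1},2s)·m^{−(s−k+1/2)}`,
Mathlib `LSeries_hasDerivAt`), **`tendsto_sub_mul_LSeries_ite_cut_cohenH_of_familyMean`** (the residue modulo ANY family-mean limits `Dl`), and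
the instantiation with `FamilyMean.tendsto_sub_one_mul_LSeries_family_euler` + the collapse `CuspSeed.tsum_term_chiDisc_mul_term_mul_isSquare_eq`
+ the two cancellations `L(𝟙_{⊥6m},s)L(𝟙_{⊥6m}μ,s) = 1` (`s = 2, 2k+1`; `FamilyMean.LSeries_coprime_mul_LSeries_coprimeMoebius`) — «`ζ(2k+1)`
disappears». USE (LEAD g13 / w8 g8 (α)(β) / w2 g13): with Lemma A p691154 and (E4) p695659 (`(s−w)L(a,s) → (2π)^w/Γ(w)·lim t^w Σ a(n)e^{−2πnt}`)
this is the VALUE of the constant term at the cusp `0` of the weight-`(k+1)` vehicle `G_e·θ(Q²·)`, up to the Jacobi factor `Q√2` and the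
algebraic `(2π)^{−w}Γ(w)`-cancellation. [folklore] beyond Cohen's numbers.
References: [Cohen1975] §2; [MontgomeryVaughan2007] §9.3; Mathlib `Mathlib.Analysis.Normed.Group.Tannery`.
-/

-- summit-side namespace `Summit.BirchSwinnertonDyer.BirchSwinnertonDyer.…` (single-conjunct summit, D-0017 layout)
set_option linter.dupNamespace false

namespace Summit.BirchSwinnertonDyer.BirchSwinnertonDyer.Theorems.PrintCFram.CuspSeed

open Filter Finset LSeries ArithmeticFunction Literature.NumberTheory.ModularForms.CohenEisenstein
  Literature.NumberTheory.QuadraticFields Summit.BirchSwinnertonDyer.BirchSwinnertonDyer.Theorems.PrintCFram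
open scoped LSeries.notation ArithmeticFunction.Moebius NumberTheorySymbols Classical Topology

/-! ## §B4 Tannery: the limit of the `(a, b)` sum as `s → w⁺` -/

/-- The change of variable `s ↦ σ = s − k + 1/2` maps `𝓝[>] (k + 1/2)` to `𝓝[>] 1`. [folklore] -/
theorem tendsto_sub_add_half_nhdsGT (k : ℕ) :
    Tendsto (fun s : ℝ ↦ s - k + 1 / 2) (𝓝[>] ((k : ℝ) + 1 / 2)) (𝓝[>] 1) := by
  refine tendsto_nhdsWithin_iff.2 ⟨?_, ?_⟩
  · have h : Tendsto (fun s : ℝ ↦ s - k + 1 / 2) (𝓝 ((k : ℝ) + 1 / 2)) (𝓝 ((k : ℝ) + 1 / 2 - k + 1 / 2)) :=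
      (tendsto_id.sub tendsto_const_nhds).add tendsto_const_nhds
    have : (k : ℝ) + 1 / 2 - k + 1 / 2 = 1 := by ring
    rw [this] at h
    exact h.mono_left nhdsWithin_le_nhds
  · filter_upwards [self_mem_nhdsWithin] with s (hs : (k : ℝ) + 1 / 2 < s)
    show (1 : ℝ) < s - k + 1 / 2
    linarith

/-- If `χ_e(ab) = 0`-type vanishing: for `a, b ≥ 1` with `ab` NOT prime to `m` (`|e| = m`, `e ≡ 1 (4)` or `4 ∣ e`), the product
`term χ_e k a · term (𝟙_{⊥M} μ χ_e) u b` vanishes. [folklore] -/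
theorem term_chiDisc_mul_term_eq_zero_of_not_coprime {e : ℤ} (he : e % 4 = 1 ∨ 4 ∣ e) {m : ℕ} (hme : e.natAbs = m) (hm : m ≠ 0)
    (M : ℕ) (k u : ℂ) {a b : ℕ} (hab : ¬ (a * b).Coprime m) :
    term (fun a : ℕ ↦ (chiDisc e a : ℂ)) k a * term (fun b : ℕ ↦ if b.Coprime M then (μ b : ℂ) * (chiDisc e b : ℂ) else 0) u b
      = 0 := by
  have h0 : chiDisc e (a * b) = 0 := (chiDisc_eq_zero_iff he hme hm (a * b)).mpr hab
  rw [chiDisc_mul_right] at h0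
  rcases mul_eq_zero.mp h0 with ha | hb
  · rw [term_def]
    simp [ha]
  · rw [mul_comm, term_def]
    simp [hb]

/-- **TANNERY FOR THE `(a, b)` SUM.** For `e ≡ 1 (mod 4)` or `4 ∣ e` with `|e| = m ≥ 1`, `k ≥ 2`, and ANY candidate limits `Dl n`
of the family means — `(σ − 1)·L(W_n, σ) → Dl n` as `σ → 1⁺` for every `n ≥ 1` prime to `m` (w3 g13's (III)) —:
`Σ_{(a,b)} χ_e(a)a^{−k}·𝟙μχ_e(b)b^{−(2s−k+1)}·(σ_s − 1)L(W_{ab}, σ_s) → Σ_{(a,b)} χ_e(a)a^{−k}·𝟙μχ_e(b)b^{−(k+2)}·Dl(ab)` as `s → (k+1/2)⁺`,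
`σ_s = s − k + 1/2` (dominated convergence: w3 g13 `FamilyMean.eventually_norm_sub_one_mul_LSeries_le` bounds `|(σ−1)L(W,σ)| ≤ 2`
uniformly; the terms with `ab` not prime to `m` or `ab = 0` vanish identically). [folklore] -/
theorem tendsto_tsum_term_mul_term_mul_family {e : ℤ} (he : e % 4 = 1 ∨ 4 ∣ e) {m : ℕ} (hme : e.natAbs = m) (hm : m ≠ 0)
    {k : ℕ} (hk : 2 ≤ k) (Dl : ℕ → ℂ)
    (hIII : ∀ n : ℕ, n ≠ 0 → n.Coprime m → Tendsto (fun t : ℝ ↦ ((t : ℂ) - 1) *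
        LSeries (fun N ↦ if Squarefree N ∧ N % 4 = 3 ∧ (2 ∣ m → N % 8 = 7) ∧
            (∀ q : ℕ, q.Prime → q ∣ m → q ≠ 2 → J(-((N : ℕ) : ℤ) | q) = 1) ∧ ¬ 3 ∣ N
          then (J(((n : ℕ) : ℤ) | N) : ℂ) else 0) t) (𝓝[>] 1) (𝓝 (Dl n))) :
    Tendsto (fun s : ℝ ↦ ∑' x : ℕ × ℕ, term (fun a : ℕ ↦ (chiDisc e a : ℂ)) k x.1 *
        term (fun b : ℕ ↦ if b.Coprime (6 * m) then (μ b : ℂ) * (chiDisc e b : ℂ) else 0) (2 * (s : ℂ) - k + 1) x.2 *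
        ((((s - k + 1 / 2 : ℝ) : ℂ) - 1) *
          LSeries (fun N ↦ if Squarefree N ∧ N % 4 = 3 ∧ (2 ∣ m → N % 8 = 7) ∧
            (∀ q : ℕ, q.Prime → q ∣ m → q ≠ 2 → J(-((N : ℕ) : ℤ) | q) = 1) ∧ ¬ 3 ∣ N
            then (J(((x.1 * x.2 : ℕ) : ℤ) | N) : ℂ) else 0) (s - k + 1 / 2 : ℝ)))
      (𝓝[>] ((k : ℝ) + 1 / 2))
      (𝓝 (∑' x : ℕ × ℕ, term (fun a : ℕ ↦ (chiDisc e a : ℂ)) k x.1 *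
        term (fun b : ℕ ↦ if b.Coprime (6 * m) then (μ b : ℂ) * (chiDisc e b : ℂ) else 0) ((k : ℂ) + 2) x.2 * Dl (x.1 * x.2))) := by
  have hk1 : 1 < (k : ℂ).re := by simp only [Complex.natCast_re]; exact_mod_cast hk
  have hσ := tendsto_sub_add_half_nhdsGT k
  -- the uniform bound on `(σ − 1)·L(W, σ)` pulled back to `s`
  have hbd := hσ.eventually (FamilyMean.eventually_norm_sub_one_mul_LSeries_le (1 : ℝ))
  refine tendsto_tsum_of_dominated_convergence
    (bound := fun x : ℕ × ℕ ↦ ‖term (fun _ : ℕ ↦ (1 : ℂ)) k x.1‖ * ‖term (fun _ : ℕ ↦ (1 : ℂ)) k x.2‖ * 2)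
    ((Summable.mul_of_nonneg (summable_norm_term_one hk1) (summable_norm_term_one hk1) (fun _ ↦ norm_nonneg _)
      (fun _ ↦ norm_nonneg _)).mul_right 2) (fun x ↦ ?_) ?_
  · -- pointwise limits
    obtain ⟨a, b⟩ := x
    simp only
    by_cases hab : (a * b).Coprime m
    · rcases eq_or_ne a 0 with rfl | ha
      · simp only [term_zero, zero_mul]; exact tendsto_const_nhds
      rcases eq_or_ne b 0 with rfl | hb
      · simp only [term_zero, zero_mul, mul_zero]; exact tendsto_const_nhds
      have hb' : (b : ℂ) ≠ 0 := Nat.cast_ne_zero.mpr hb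
      haveI : NeZero (b : ℂ) := ⟨hb'⟩
      -- the `b`-term is continuous in `s`
      have htb : Tendsto (fun s : ℝ ↦ term (fun b : ℕ ↦ if b.Coprime (6 * m) then (μ b : ℂ) * (chiDisc e b : ℂ) else 0)
          (2 * (s : ℂ) - k + 1) b) (𝓝[>] ((k : ℝ) + 1 / 2))
          (𝓝 (term (fun b : ℕ ↦ if b.Coprime (6 * m) then (μ b : ℂ) * (chiDisc e b : ℂ) else 0) ((k : ℂ) + 2) b)) := by
        simp only [term_of_ne_zero hb]
        have hc : Continuous fun s : ℝ ↦ (if b.Coprime (6 * m) then (μ b : ℂ) * (chiDisc e b : ℂ) else 0) /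
            (b : ℂ) ^ (2 * (s : ℂ) - k + 1) :=
          continuous_const.div ((continuous_const_cpow (b : ℂ)).comp (by fun_prop))
            (fun s ↦ by rw [Ne, Complex.cpow_eq_zero_iff, not_and_or]; exact Or.inl hb')
        have h := hc.tendsto ((k : ℝ) + 1 / 2)
        have heq : (2 * (((k : ℝ) + 1 / 2 : ℝ) : ℂ) - k + 1) = (k : ℂ) + 2 := by push_cast; ring
        rw [heq] at h
        exact h.mono_left nhdsWithin_le_nhds
      have hL := (hIII (a * b) (mul_ne_zero ha hb) hab).comp hσ
      have hconst : Tendsto (fun _ : ℝ ↦ term (fun a : ℕ ↦ (chiDisc e a : ℂ)) k a) (𝓝[>] ((k : ℝ) + 1 / 2))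
          (𝓝 (term (fun a : ℕ ↦ (chiDisc e a : ℂ)) k a)) := tendsto_const_nhds
      have := (hconst.mul htb).mul hL
      refine this.congr fun s ↦ ?_
      simp only [Function.comp_apply]
    · -- `ab` not prime to `m`: everything vanishes
      have h0 : ∀ u : ℂ, term (fun a : ℕ ↦ (chiDisc e a : ℂ)) k a *
          term (fun b : ℕ ↦ if b.Coprime (6 * m) then (μ b : ℂ) * (chiDisc e b : ℂ) else 0) u b = 0 :=
        fun u ↦ term_chiDisc_mul_term_eq_zero_of_not_coprime he hme hm (6 * m) k u hab
      simp only [h0, zero_mul]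
      exact tendsto_const_nhds
  · -- domination
    filter_upwards [hbd, self_mem_nhdsWithin] with s hs2 (hsw : (k : ℝ) + 1 / 2 < s) x
    have hre : ((k : ℂ)).re ≤ (2 * (s : ℂ) - k + 1).re := by
      simp only [Complex.sub_re, Complex.add_re, Complex.mul_re, Complex.re_ofNat, Complex.im_ofNat, Complex.ofReal_re,
        Complex.ofReal_im, Complex.natCast_re, Complex.one_re, mul_zero, sub_zero]
      linarith
    rw [norm_mul, norm_mul]
    gcongr
    · exact norm_term_le_norm_term_one (norm_chiDisc_le_one e) _ _
    · exact (norm_term_le_of_re_le_re _ hre _).trans (norm_term_le_norm_term_one (norm_ite_moebius_chiDisc_le_one e _) _ _)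
    · have h := hs2 (fun N ↦ if Squarefree N ∧ N % 4 = 3 ∧ (2 ∣ m → N % 8 = 7) ∧
          (∀ q : ℕ, q.Prime → q ∣ m → q ≠ 2 → J(-((N : ℕ) : ℤ) | q) = 1) ∧ ¬ 3 ∣ N
          then (J(((x.1 * x.2 : ℕ) : ℤ) | N) : ℂ) else 0) (fun N ↦ by
          split_ifs
          · exact norm_jacobiSym_le_one _ _
          · rw [norm_zero]; exact zero_le_one)
      linarith [h]


/-! ## §B5 Continuity of the elementary factor -/

/-- Continuity of `s ↦ L(f, 2s)` at `s = k + 1/2` when `L(f, ·)` converges absolutely somewhere to the left of `2k + 1`. [folklore] -/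
theorem tendsto_LSeries_two_mul {f : ℕ → ℂ} {s₀ : ℂ} (hf : LSeriesSummable f s₀) {k : ℕ} (hlt : s₀.re < 2 * k + 1) :
    Tendsto (fun s : ℝ ↦ LSeries f (2 * (s : ℂ))) (𝓝 ((k : ℝ) + 1 / 2)) (𝓝 (LSeries f (2 * k + 1))) := by
  have habs : abscissaOfAbsConv f < ((2 * k + 1 : ℂ)).re := by
    refine lt_of_le_of_lt hf.abscissaOfAbsConv_le ?_
    have : ((2 * k + 1 : ℂ)).re = 2 * k + 1 := by simp
    rw [this]
    exact_mod_cast hlt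
  have hc := (LSeries_hasDerivAt habs).continuousAt.tendsto
  have h2 : Tendsto (fun s : ℝ ↦ 2 * (s : ℂ)) (𝓝 ((k : ℝ) + 1 / 2)) (𝓝 (2 * k + 1)) := by
    have := ((Complex.continuous_ofReal.tendsto ((k : ℝ) + 1 / 2)).const_mul (2 : ℂ))
    convert this using 2
    push_cast; ring
  exact hc.comp h2

/-- Continuity of `s ↦ m^{−(s − k + 1/2)}` at `s = k + 1/2` (value `m^{−1}`). [folklore] -/
theorem tendsto_natCast_cpow_neg {m : ℕ} (hm : m ≠ 0) (k : ℕ) :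
    Tendsto (fun s : ℝ ↦ (m : ℂ) ^ (-((s : ℂ) - k + 1 / 2))) (𝓝 ((k : ℝ) + 1 / 2)) (𝓝 ((m : ℂ) ^ (-1 : ℂ))) := by
  haveI : NeZero (m : ℂ) := ⟨Nat.cast_ne_zero.mpr hm⟩
  have hc : Continuous fun s : ℝ ↦ (m : ℂ) ^ (-((s : ℂ) - k + 1 / 2)) := (continuous_const_cpow (m : ℂ)).comp (by fun_prop)
  have h := hc.tendsto ((k : ℝ) + 1 / 2)
  have heq : (-((((k : ℝ) + 1 / 2 : ℝ) : ℂ) - k + 1 / 2)) = (-1 : ℂ) := by push_cast; ring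
  rwa [heq] at h

/-- **Continuity of the elementary factor** `A(s)·m^{−(s−k+1/2)}`, `A(s) = c_k π^{−k} L(𝟙_{⊥6m},2s) L(𝟙_{⊥6m}id^{2k−1},2s)`, at
`s = k + 1/2`: limit `A(k+1/2)·m^{−1}` with `A(k+1/2) = c_k π^{−k} L(𝟙_{⊥6m}, 2k+1) L(𝟙_{⊥6m} id^{2k−1}, 2k+1)`. [folklore] -/
theorem tendsto_elementaryFactor {m : ℕ} (hm : m ≠ 0) {k : ℕ} (hk : 2 ≤ k) :
    Tendsto (fun s : ℝ ↦ ((-1 : ℂ) ^ (k / 2) * ((k - 1).factorial : ℂ) / 2 ^ (k - 1) / (Real.pi : ℂ) ^ k *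
          (LSeries (fun a : ℕ ↦ if a.Coprime (6 * m) then (1 : ℂ) else 0) (2 * (s : ℂ)) *
            LSeries (fun b : ℕ ↦ if b.Coprime (6 * m) then (b : ℂ) ^ (2 * k - 1) else 0) (2 * (s : ℂ)))) *
        (m : ℂ) ^ (-((s : ℂ) - k + 1 / 2)))
      (𝓝[>] ((k : ℝ) + 1 / 2))
      (𝓝 (((-1 : ℂ) ^ (k / 2) * ((k - 1).factorial : ℂ) / 2 ^ (k - 1) / (Real.pi : ℂ) ^ k *
          (LSeries (fun a : ℕ ↦ if a.Coprime (6 * m) then (1 : ℂ) else 0) (2 * k + 1) *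
            LSeries (fun b : ℕ ↦ if b.Coprime (6 * m) then (b : ℂ) ^ (2 * k - 1) else 0) (2 * k + 1))) *
        (m : ℂ) ^ (-1 : ℂ))) := by
  have hk' : (2 : ℝ) ≤ k := by exact_mod_cast hk
  have h1 : Tendsto (fun s : ℝ ↦ LSeries (fun a : ℕ ↦ if a.Coprime (6 * m) then (1 : ℂ) else 0) (2 * (s : ℂ)))
      (𝓝 ((k : ℝ) + 1 / 2)) (𝓝 (LSeries (fun a : ℕ ↦ if a.Coprime (6 * m) then (1 : ℂ) else 0) (2 * k + 1))) :=
    tendsto_LSeries_two_mul (LSeriesSummable_ite_coprime_one (6 * m) (s := 2) (by norm_num))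
      (by simp only [Complex.re_ofNat]; linarith)
  have h2 : Tendsto (fun s : ℝ ↦ LSeries (fun b : ℕ ↦ if b.Coprime (6 * m) then (b : ℂ) ^ (2 * k - 1) else 0) (2 * (s : ℂ)))
      (𝓝 ((k : ℝ) + 1 / 2))
      (𝓝 (LSeries (fun b : ℕ ↦ if b.Coprime (6 * m) then (b : ℂ) ^ (2 * k - 1) else 0) (2 * k + 1))) := by
    refine tendsto_LSeries_two_mul (s₀ := (2 * k + 1 / 2 : ℝ))
      (LSeriesSummable_ite_coprime_pow (6 * m) (2 * k - 1) ?_) ?_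
    · rw [Nat.cast_sub (by omega), Nat.cast_mul, Nat.cast_two, Nat.cast_one, sub_add_cancel, Complex.ofReal_re]
      linarith
    · rw [Complex.ofReal_re]; linarith
  have h := ((h1.mul h2).const_mul ((-1 : ℂ) ^ (k / 2) * ((k - 1).factorial : ℂ) / 2 ^ (k - 1) / (Real.pi : ℂ) ^ k)).mul
    (tendsto_natCast_cpow_neg hm k)
  exact h.mono_left nhdsWithin_le_nhds

/-! ## §B6 THE RESIDUE OF THE CUT COHEN `L`-SERIES (modulo the family means) -/

/-- **(E3) THE RESIDUE, modulo the family means.** For `e` a fundamental discriminant or `1` (`m = |e|`), parity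
`(−1)^k m = −e`, `k ≥ 2`, and ANY candidate limits `Dl n` of w3 g13's family means (`(σ−1)L(W_n,σ) → Dl n` for `n ≥ 1` prime
to `m`): with `w = k + 1/2`,
`(s − w)·Σ_{a ∈ CUT} H(k,a) a^{−s} → [c_k π^{−k} L(𝟙_{⊥6m},2k+1) L(𝟙_{⊥6m}id^{2k−1},2k+1)]·m^{−1}·Σ_{(a,b)} χ_e(a)a^{−k}·𝟙μχ_e(b)b^{−(k+2)}·Dl(ab)`
as `s → w⁺` (real). The `(a,b)` sum is evaluated by `CuspSeed.tsum_term_chiDisc_mul_term_mul_isSquare_eq`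
(`…CuspSeedDoubleSumCollapse.lean`) once `Dl` is w3 g13's Euler form. [cite: Cohen1975, §2 (definition of h(r,N) and of H(r,N))] -/
theorem tendsto_sub_mul_LSeries_ite_cut_cohenH_of_familyMean {e : ℤ}
    (he : e = 1 ∨ (e % 4 = 1 ∧ Squarefree e ∧ e ≠ 1) ∨ (4 ∣ e ∧ (e / 4 % 4 = 2 ∨ e / 4 % 4 = 3) ∧ Squarefree (e / 4)))
    {m : ℕ} (hme : e.natAbs = m) {k : ℕ} (hk : 2 ≤ k) (hsign : (-1 : ℤ) ^ k * m = -e) (Dl : ℕ → ℂ)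
    (hIII : ∀ n : ℕ, n ≠ 0 → n.Coprime m → Tendsto (fun t : ℝ ↦ ((t : ℂ) - 1) *
        LSeries (fun N ↦ if Squarefree N ∧ N % 4 = 3 ∧ (2 ∣ m → N % 8 = 7) ∧
            (∀ q : ℕ, q.Prime → q ∣ m → q ≠ 2 → J(-((N : ℕ) : ℤ) | q) = 1) ∧ ¬ 3 ∣ N
          then (J(((n : ℕ) : ℤ) | N) : ℂ) else 0) t) (𝓝[>] 1) (𝓝 (Dl n))) :
    Tendsto (fun s : ℝ ↦ ((s - ((k : ℝ) + 1 / 2) : ℝ) : ℂ) *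
        LSeries (fun a : ℕ ↦ if m ∣ a ∧ a / m % 4 = 3 ∧
          (∀ q : ℕ, q.Prime → q ∣ m → q ≠ 2 → J(-((a / m : ℕ) : ℤ) | q) = 1) ∧ (2 ∣ m → a / m % 8 = 7) ∧ ¬ 3 ∣ a / m
          then (cohenH k a : ℂ) else 0) s)
      (𝓝[>] ((k : ℝ) + 1 / 2))
      (𝓝 (((-1 : ℂ) ^ (k / 2) * ((k - 1).factorial : ℂ) / 2 ^ (k - 1) / (Real.pi : ℂ) ^ k *
          (LSeries (fun a : ℕ ↦ if a.Coprime (6 * m) then (1 : ℂ) else 0) (2 * k + 1) *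
            LSeries (fun b : ℕ ↦ if b.Coprime (6 * m) then (b : ℂ) ^ (2 * k - 1) else 0) (2 * k + 1))) *
        (m : ℂ) ^ (-1 : ℂ) *
        ∑' x : ℕ × ℕ, term (fun a : ℕ ↦ (chiDisc e a : ℂ)) k x.1 *
          term (fun b : ℕ ↦ if b.Coprime (6 * m) then (μ b : ℂ) * (chiDisc e b : ℂ) else 0) ((k : ℂ) + 2) x.2 *
          Dl (x.1 * x.2))) := by
  have he4 : e % 4 = 1 ∨ 4 ∣ e := by
    rcases he with rfl | ⟨h, -, -⟩ | ⟨h, -, -⟩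
    · exact Or.inl (by decide)
    · exact Or.inl h
    · exact Or.inr h
  have he0 : e ≠ 0 := by
    rintro rfl
    rcases he with h | ⟨h, -, -⟩ | ⟨-, h, -⟩ <;> norm_num at h
  have hm : m ≠ 0 := by rw [← hme]; exact Int.natAbs_ne_zero.mpr he0
  have hT := tendsto_tsum_term_mul_term_mul_family he4 hme hm hk Dl hIII
  have hA := tendsto_elementaryFactor hm hk
  refine (hA.mul hT).congr' ?_
  filter_upwards [self_mem_nhdsWithin] with s (hs : (k : ℝ) + 1 / 2 < s)
  have hs' : (k : ℝ) + 1 / 2 < (s : ℂ).re := by rwa [Complex.ofReal_re]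
  rw [LSeries_ite_cut_cohenH_eq_mul_tsum he hme hk hsign hs']
  have hcast : ((s - k + 1 / 2 : ℝ) : ℂ) = (s : ℂ) - k + 1 / 2 := by push_cast; ring
  have hcast2 : (((s - ((k : ℝ) + 1 / 2)) : ℝ) : ℂ) = ((s - k + 1 / 2 : ℝ) : ℂ) - 1 := by push_cast; ring
  rw [hcast2, hcast]
  symm
  rw [mul_comm (((s : ℂ) - k + 1 / 2) - 1), mul_assoc _ _ (((s : ℂ) - k + 1 / 2) - 1), ← tsum_mul_right]
  congr 1
  refine tsum_congr fun x ↦ ?_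
  ring


/-! ## §B7 THE RESIDUE with w3 g13's family means: the explicit constant -/

/-- Shift: `L(𝟙_{⊥M} id^{2k−1}, 2k+1) = L(𝟙_{⊥M}, 2)` (`k ≥ 1`). [folklore] -/
theorem LSeries_ite_coprime_pow_at_eq (M : ℕ) {k : ℕ} (hk : 1 ≤ k) :
    LSeries (fun b : ℕ ↦ if b.Coprime M then (b : ℂ) ^ (2 * k - 1) else 0) (2 * k + 1) =
      LSeries (fun a : ℕ ↦ if a.Coprime M then (1 : ℂ) else 0) 2 := by
  refine tsum_congr fun n ↦ ?_
  rcases eq_or_ne n 0 with rfl | hn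
  · simp
  have hnc : (n : ℂ) ≠ 0 := Nat.cast_ne_zero.mpr hn
  rw [term_of_ne_zero hn, term_of_ne_zero hn]
  split_ifs
  · have h2k : (2 * (k : ℂ) + 1) = ((2 * k - 1 : ℕ) : ℂ) + 2 := by
      rw [Nat.cast_sub (by omega)]; push_cast; ring
    rw [h2k, Complex.cpow_add _ _ hnc, Complex.cpow_natCast, Complex.cpow_two]
    have : (n : ℂ) ^ (2 * k - 1) ≠ 0 := pow_ne_zero _ hnc
    field_simp
  · simp

/-- **(E3) THE RESIDUE OF THE CUT COHEN `L`-SERIES AT `s = k + 1/2`.** For `e` a fundamental discriminant or `1`,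
`m = |e|`, parity `(−1)^k m = −e`, `k ≥ 2`, `w = k + 1/2`:
`(s − w) · Σ_{a ∈ CUT} H(k,a) a^{−s} ⟶ R` as `s → w⁺` (real), with
`R = (−1)^{⌊k/2⌋}(k−1)!/2^{k−1} · π^{−k} · κ_m · L(𝟙_{⊥m}, 2k) · m^{−1}`,
`κ_m = (1/8 | 1/4)·(1 | 2/3)·Π_{q ∈ m.primeFactors ∖ {2}} (q−1)/(2q)` (w3 g13's density constant) and
`L(𝟙_{⊥m}, 2k) = ζ(2k)·Π_{q∣m}(1 − q^{−2k})` — the residue of crux notes `Lines/eisenstein-resource-bdp-line-w5g5-cusp-seed.md` §0/§5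
(there for `F_e(z)`; here for the registered `a = m·n'` indexing, hence the extra `m^{−w}`; `m^{−w}·m^{k−1}·√m = m^{−1}`).
INPUTS: (E2) unfolding, LEMMA B (E1), (C) w5 g5 p692672, the family means (D) = w3 g13
`FamilyMean.tendsto_sub_one_mul_LSeries_family_euler` + `eventually_norm_sub_one_mul_LSeries_le` (Tannery), the collapse
`CuspSeed.tsum_term_chiDisc_mul_term_mul_isSquare_eq`, and the two cancellations `L(𝟙_{⊥6m},s)·L(𝟙_{⊥6m}μ,s) = 1` at `s = 2, 2k+1`
(w3 g13 `FamilyMean.LSeries_coprime_mul_LSeries_coprimeMoebius`) — the «`ζ(2k+1)` disappears» step. With (E4)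
`CuspSeed.tendsto_sub_mul_LSeries_of_tendsto_rpow_smul_tsum` and Lemma A p691154 this is the VALUE of the constant term of the weight-`(k+1)`
vehicle `G_e·θ(Q²·)` at the cusp `0` up to the factors w8 g8's (α)/(β) supply. [cite: Cohen1975, §2 (definition of h(r,N) and of H(r,N))] -/
theorem tendsto_sub_mul_LSeries_ite_cut_cohenH {e : ℤ}
    (he : e = 1 ∨ (e % 4 = 1 ∧ Squarefree e ∧ e ≠ 1) ∨ (4 ∣ e ∧ (e / 4 % 4 = 2 ∨ e / 4 % 4 = 3) ∧ Squarefree (e / 4)))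
    {m : ℕ} (hme : e.natAbs = m) {k : ℕ} (hk : 2 ≤ k) (hsign : (-1 : ℤ) ^ k * m = -e) :
    Tendsto (fun s : ℝ ↦ ((s - ((k : ℝ) + 1 / 2) : ℝ) : ℂ) *
        LSeries (fun a : ℕ ↦ if m ∣ a ∧ a / m % 4 = 3 ∧
          (∀ q : ℕ, q.Prime → q ∣ m → q ≠ 2 → J(-((a / m : ℕ) : ℤ) | q) = 1) ∧ (2 ∣ m → a / m % 8 = 7) ∧ ¬ 3 ∣ a / m
          then (cohenH k a : ℂ) else 0) s)
      (𝓝[>] ((k : ℝ) + 1 / 2))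
      (𝓝 ((-1 : ℂ) ^ (k / 2) * ((k - 1).factorial : ℂ) / 2 ^ (k - 1) / (Real.pi : ℂ) ^ k *
        ((if 2 ∣ m then 1 / 8 else 1 / 4) * (if 3 ∣ m then 1 else 2 / 3) *
          ∏ q ∈ m.primeFactors.erase 2, (((q : ℂ) - 1) / (2 * q))) *
        LSeries (fun a : ℕ ↦ if a.Coprime m then (1 : ℂ) else 0) (2 * k) * (m : ℂ) ^ (-1 : ℂ))) := by
  have hk1 : 1 ≤ k := by omega
  have he4 : e % 4 = 1 ∨ 4 ∣ e := by
    rcases he with rfl | ⟨h, -, -⟩ | ⟨h, -, -⟩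
    · exact Or.inl (by decide)
    · exact Or.inl h
    · exact Or.inr h
  have he0 : e ≠ 0 := by
    rintro rfl
    rcases he with h | ⟨h, -, -⟩ | ⟨-, h, -⟩ <;> norm_num at h
  have hm : m ≠ 0 := by rw [← hme]; exact Int.natAbs_ne_zero.mpr he0
  set κ : ℂ := (if 2 ∣ m then 1 / 8 else 1 / 4) * (if 3 ∣ m then 1 else 2 / 3) *
    ∏ q ∈ m.primeFactors.erase 2, (((q : ℂ) - 1) / (2 * q)) with hκ
  set C₀ : ℂ := LSeries (fun g : ℕ ↦ if g.Coprime (6 * m) then (μ g : ℂ) else 0) 2 * κ with hC₀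
  -- w3 g13's family means, in the shape `[n = □]·C₀·Π ℓ/(ℓ+1)`
  have hIII : ∀ n : ℕ, n ≠ 0 → n.Coprime m → Tendsto (fun t : ℝ ↦ ((t : ℂ) - 1) *
      LSeries (fun N ↦ if Squarefree N ∧ N % 4 = 3 ∧ (2 ∣ m → N % 8 = 7) ∧
          (∀ q : ℕ, q.Prime → q ∣ m → q ≠ 2 → J(-((N : ℕ) : ℤ) | q) = 1) ∧ ¬ 3 ∣ N
        then (J(((n : ℕ) : ℤ) | N) : ℂ) else 0) t) (𝓝[>] 1)
      (𝓝 ((fun n : ℕ ↦ if IsSquare n then C₀ * ∏ ℓ ∈ n.primeFactors \ (6 * m).primeFactors, ((ℓ : ℂ) / ((ℓ : ℂ) + 1))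
        else 0) n)) := by
    intro n hn hmn
    have h := FamilyMean.tendsto_sub_one_mul_LSeries_family_euler hm hn hmn
    have hval : (if IsSquare n then LSeries (fun g : ℕ ↦ if g.Coprime (6 * m) then (μ g : ℂ) else 0) 2 *
        ((if 2 ∣ m then 1 / 8 else 1 / 4) * (if 3 ∣ m then 1 else 2 / 3) *
          (∏ q ∈ m.primeFactors.erase 2, ((q : ℂ) - 1) / (2 * q)) *
          ∏ ℓ ∈ n.primeFactors \ (6 * m).primeFactors, ((ℓ : ℂ) / (ℓ + 1))) else 0) =
        (fun n : ℕ ↦ if IsSquare n then C₀ * ∏ ℓ ∈ n.primeFactors \ (6 * m).primeFactors, ((ℓ : ℂ) / ((ℓ : ℂ) + 1))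
          else 0) n := by
      simp only
      rw [← hκ]
      by_cases hsq : IsSquare n
      · rw [if_pos hsq, if_pos hsq, hC₀]; ring
      · rw [if_neg hsq, if_neg hsq]
    rw [hval] at h
    exact h
  have main := tendsto_sub_mul_LSeries_ite_cut_cohenH_of_familyMean he hme hk hsign _ hIII
  rw [tsum_term_chiDisc_mul_term_mul_isSquare_eq he4 hme hm hk C₀, LSeries_ite_coprime_pow_at_eq (6 * m) hk1] at main
  have hk2 : (2 : ℝ) ≤ k := by exact_mod_cast hk
  have h1 := FamilyMean.LSeries_coprime_mul_LSeries_coprimeMoebius (6 * m) (s := 2 * k + 1)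
    (by simp only [Complex.add_re, Complex.mul_re, Complex.re_ofNat, Complex.natCast_re, Complex.im_ofNat, Complex.natCast_im,
      Complex.one_re, mul_zero, sub_zero]; linarith)
  have h2 := FamilyMean.LSeries_coprime_mul_LSeries_coprimeMoebius (6 * m) (s := 2) (by norm_num)
  have hV : ((-1 : ℂ) ^ (k / 2) * ((k - 1).factorial : ℂ) / 2 ^ (k - 1) / (Real.pi : ℂ) ^ k *
          (LSeries (fun a : ℕ ↦ if a.Coprime (6 * m) then (1 : ℂ) else 0) (2 * k + 1) *
            LSeries (fun a : ℕ ↦ if a.Coprime (6 * m) then (1 : ℂ) else 0) 2)) *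
        (m : ℂ) ^ (-1 : ℂ) *
        (C₀ * (LSeries (fun b : ℕ ↦ if b.Coprime (6 * m) then (μ b : ℂ) else 0) (2 * k + 1) *
          LSeries (fun a : ℕ ↦ if a.Coprime m then (1 : ℂ) else 0) (2 * k))) =
      (-1 : ℂ) ^ (k / 2) * ((k - 1).factorial : ℂ) / 2 ^ (k - 1) / (Real.pi : ℂ) ^ k * κ *
        LSeries (fun a : ℕ ↦ if a.Coprime m then (1 : ℂ) else 0) (2 * k) * (m : ℂ) ^ (-1 : ℂ) := by
    rw [hC₀]
    calc _ = (-1 : ℂ) ^ (k / 2) * ((k - 1).factorial : ℂ) / 2 ^ (k - 1) / (Real.pi : ℂ) ^ k * κ *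
          LSeries (fun a : ℕ ↦ if a.Coprime m then (1 : ℂ) else 0) (2 * k) * (m : ℂ) ^ (-1 : ℂ) *
          (LSeries (fun a : ℕ ↦ if a.Coprime (6 * m) then (1 : ℂ) else 0) (2 * k + 1) *
            LSeries (fun b : ℕ ↦ if b.Coprime (6 * m) then (μ b : ℂ) else 0) (2 * k + 1)) *
          (LSeries (fun a : ℕ ↦ if a.Coprime (6 * m) then (1 : ℂ) else 0) 2 *
            LSeries (fun g : ℕ ↦ if g.Coprime (6 * m) then (μ g : ℂ) else 0) 2) := by ring
      _ = _ := by rw [h1, h2, mul_one, mul_one]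
  rw [hV] at main
  exact main


end Summit.BirchSwinnertonDyer.BirchSwinnertonDyer.Theorems.PrintCFram.CuspSeed
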